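import Summits.RiemannHypothesis.RiemannHypothesis.Theorems.Splittings.RobinFiniteThetaRel
import HarnessLib

/-!
# RobinFiniteThetaRelWindow2 — gen 13 θ-CEILING LIFT, part 2/6 (R1b₂): the sharp window and the `Q ≥ 6√P` cases re-read

Cell rh-split, seat rh-split-robin-finite g13 (card `cards/SPLIT-robin-finite.md` §20, «θ-CEILING LIFT WITH NO NEW INPUT»).
A use-site audit of the tree's exchange engine shows that above the `Q`-scale every `θ`-evaluation consumes only RELATIVE precision
— RH-free from the two named facts the engine already carries, Büthe 2018 Thm 2 (`x ≤ 10¹⁹`) and BKLNW 2021 §1.2 (`x ≥ 10¹⁹`) — except the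
E-side term `S²(x) = (θ(x) − x)²/(x² log x)`, which BKLNW bounds by `1.43641·10⁻⁹/log⁵x`.  Parts 1–6 re-read the engine accordingly: above
`2.5·10²²` NO Schoenfeld-form window, NO Büthe 2016, NO range condition `4.92·√(X/log X) ≤ T`; RH to height `T` enters only through the
zero side, and the budget acquires the `T`-independent S²-price `2.07·10⁻¹⁶·√X` (BKLNW ceiling `X ≲ 5.5·10³⁰`).

This part (0 `def`): `window_bound2R`, `gain_caseA6R`, `gain_caseC6R`, `window_caseC6R` — bodies of the tree's `window_bound2W`, `gain_caseA6W`,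
`gain_caseC6W`, `window_caseC6W` VERBATIM with the window hypothesis replaced by the two RH-free facts (`theta_…R`, `thetaP_boundsR`).

HONEST LABEL: SPLITTING SEARCH over kernel-typed RH-EQUIVALENCES; a splitting A ∧ B ⟹ RH is CONDITIONAL
bookkeeping unless A and B are both proved; nothing here bears on the truth of RH.
-/

set_option linter.dupNamespace false

noncomputable section

namespace Summit.RiemannHypothesis.RiemannHypothesis.Theorems.Splittings.RobinFiniteE3

open Real Filter Finset
open scoped Chebyshev
open Literature.NumberTheory.LFunctions Literature.NumberTheory.DiophantineGeometry
open RobinAnalyticSharp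

section LargePRel
open RobinAnalytic

/-- R1 · `window_bound2W` re-read RH-free (gen 13; no `B`). **Two-piece window bound.** For a natural `y ≥ 2³⁰` with `400 y ≤ P ≤ B` and `Q ≤ y`:
`∑_{Q < p ≤ P} 1/p² ≥ (0.9009/log(20y) + 0.09244/log(400y))/y` (layer cake over `(y, 400y]`, the count
`#{y < p ≤ n} ≥ (0.99947 n − 1.00053 y)/log T` with `T = 20y` on `(y, 20y]` and `T = 400y` on `(20y, 400y]`). -/
theorem window_bound2R (h18 : Buthe2018_thm2_theta) (h21 : BroadbentEtAl2021_theta_rel_1e19)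
    {y P Q : ℕ} (hy : (2 : ℝ) ^ 30 ≤ y) (hyP : 400 * y ≤ P) (hQy : Q ≤ y) :
    (0.9009 / Real.log (20 * y) + 0.09244 / Real.log (400 * y)) / y ≤
      ∑ p ∈ (Nat.primesLE P).filter (fun p => Q < p), ((p : ℝ) ^ 2)⁻¹ := by
  classical
  have hy1R : (1073741824 : ℝ) ≤ y := le_trans (by norm_num) hy
  have hy1 : 1073741824 ≤ y := by exact_mod_cast hy1R
  have hy0 : (0 : ℝ) < y := by linarith
  set z := 400 * y with hz
  set m := 20 * y with hm
  have hym : y ≤ m := by omega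
  have hmz : m ≤ z := by omega
  have hyz : y ≤ z := by omega
  -- restrict to the primes in `(y, z]`
  have hsub : (Nat.primesLE z).filter (fun p => y < p) ⊆ (Nat.primesLE P).filter (fun p => Q < p) := by
    intro p hp
    obtain ⟨hp1, hyp⟩ := Finset.mem_filter.1 hp
    obtain ⟨hpz, hp'⟩ := Nat.mem_primesLE.1 hp1
    exact Finset.mem_filter.2 ⟨Nat.mem_primesLE.2 ⟨hpz.trans hyP, hp'⟩, lt_of_le_of_lt hQy hyp⟩
  refine le_trans ?_ (Finset.sum_le_sum_of_subset_of_nonneg hsub fun p _ _ => by positivity)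
  refine le_trans ?_ (layer_cake y z)
  -- pointwise: `#{y < p ≤ n} ≥ (0.99947 n − 1.00053 y)/log T` for `n ≤ T`
  have hcount : ∀ n ∈ Ioc y z, ∀ T : ℝ, (n : ℝ) ≤ T →
      (0.99947 * n - 1.00053 * y) / Real.log T ≤ #((Nat.primesLE n).filter (fun p => y < p)) := by
    intro n hn T hnT
    rw [Finset.mem_Ioc] at hn
    have hnR : (y : ℝ) + 1 ≤ n := by exact_mod_cast hn.1
    have hn30 : (2 : ℝ) ^ 30 ≤ n := by linarith
    have h1 := theta_sub_theta_le_card_mul_log y n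
    have h2 := theta_ge_99947R h18 h21 hn30
    have h3 := theta_le_100053R h18 h21 hy
    have hlogn : 0 < Real.log n := Real.log_pos (by linarith)
    have hlogT : Real.log n ≤ Real.log T := Real.log_le_log (by linarith) hnT
    have hlogT0 : 0 < Real.log T := lt_of_lt_of_le hlogn hlogT
    set c : ℝ := (#((Nat.primesLE n).filter (fun p => y < p)) : ℝ) with hc
    have hc0 : 0 ≤ c := by positivity
    by_cases hneg : (0.99947 : ℝ) * n - 1.00053 * y ≤ 0
    · exact le_trans (div_nonpos_of_nonpos_of_nonneg hneg hlogT0.le) hc0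
    rw [not_le] at hneg
    rw [div_le_iff₀ hlogT0]
    calc 0.99947 * n - 1.00053 * y ≤ θ n - θ y := by linarith
      _ ≤ c * Real.log n := h1
      _ ≤ c * Real.log T := by gcongr
  have hd0 : ∀ n ∈ Ioc y z, 0 ≤ (1 / ((n : ℝ) * (n + 1)) - 1 / (((n : ℝ) + 1) * (n + 2))) := by
    intro n hn
    rw [Finset.mem_Ioc] at hn
    rw [weight_eq n (by omega)]
    positivity
  have hlogm : 0 < Real.log (20 * y) := Real.log_pos (by linarith)
  have hlogzz : 0 < Real.log (400 * y) := Real.log_pos (by linarith)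
  -- piece 0: `(y, 20y]` with `T = 20y`
  have hpiece0 : 0.9009 / y / Real.log (20 * y) ≤
      ∑ n ∈ Ioc y m, (1 / ((n : ℝ) * (n + 1)) - 1 / (((n : ℝ) + 1) * (n + 2))) *
        #((Nat.primesLE n).filter (fun p => y < p)) := by
    calc 0.9009 / y / Real.log (20 * y)
        ≤ ∑ n ∈ Ioc y m, (1 / ((n : ℝ) * (n + 1)) - 1 / (((n : ℝ) + 1) * (n + 2))) *
            ((0.99947 * n - 1.00053 * y) / Real.log (20 * y)) := by
          have hsum : ∑ n ∈ Ioc y m, (1 / ((n : ℝ) * (n + 1)) - 1 / (((n : ℝ) + 1) * (n + 2))) *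
              ((0.99947 * n - 1.00053 * y) / Real.log (20 * y)) =
              (0.99947 * (2 / ((y : ℝ) + 2) - 2 / ((m : ℝ) + 2)) -
                1.00053 * y * (1 / (((y : ℝ) + 1) * (y + 2)) - 1 / (((m : ℝ) + 1) * (m + 2)))) /
                Real.log (20 * y) := by
            rw [← sum_mul_weight hym, ← sum_weight hym, Finset.mul_sum, Finset.mul_sum,
              ← Finset.sum_sub_distrib, Finset.sum_div]
            refine Finset.sum_congr rfl fun n _ => ?_
            ring
          rw [hsum, hm]
          push_cast
          exact div_le_div_of_nonneg_right (bracket0_ge hy) hlogm.le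
      _ ≤ _ := by
          refine Finset.sum_le_sum fun n hn => ?_
          have hn' : n ∈ Ioc y z := by
            rw [Finset.mem_Ioc] at hn ⊢; exact ⟨hn.1, hn.2.trans hmz⟩
          have hnT : (n : ℝ) ≤ 20 * y := by
            rw [Finset.mem_Ioc] at hn; exact_mod_cast hn.2
          exact mul_le_mul_of_nonneg_left (hcount n hn' _ hnT) (hd0 n hn')
  -- piece 1: `(20y, 400y]` with `T = 400y`
  have hpiece1 : 0.09244 / y / Real.log (400 * y) ≤
      ∑ n ∈ Ioc m z, (1 / ((n : ℝ) * (n + 1)) - 1 / (((n : ℝ) + 1) * (n + 2))) *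
        #((Nat.primesLE n).filter (fun p => y < p)) := by
    calc 0.09244 / y / Real.log (400 * y)
        ≤ ∑ n ∈ Ioc m z, (1 / ((n : ℝ) * (n + 1)) - 1 / (((n : ℝ) + 1) * (n + 2))) *
            ((0.99947 * n - 1.00053 * y) / Real.log (400 * y)) := by
          have hsum : ∑ n ∈ Ioc m z, (1 / ((n : ℝ) * (n + 1)) - 1 / (((n : ℝ) + 1) * (n + 2))) *
              ((0.99947 * n - 1.00053 * y) / Real.log (400 * y)) =
              (0.99947 * (2 / ((m : ℝ) + 2) - 2 / ((z : ℝ) + 2)) -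
                1.00053 * y * (1 / (((m : ℝ) + 1) * (m + 2)) - 1 / (((z : ℝ) + 1) * (z + 2)))) /
                Real.log (400 * y) := by
            rw [← sum_mul_weight hmz, ← sum_weight hmz, Finset.mul_sum, Finset.mul_sum,
              ← Finset.sum_sub_distrib, Finset.sum_div]
            refine Finset.sum_congr rfl fun n _ => ?_
            ring
          rw [hsum, hm, hz]
          push_cast
          exact div_le_div_of_nonneg_right (bracket1_ge hy) hlogzz.le
      _ ≤ _ := by
          refine Finset.sum_le_sum fun n hn => ?_
          have hn' : n ∈ Ioc y z := by
            rw [Finset.mem_Ioc] at hn ⊢; exact ⟨lt_of_le_of_lt hym hn.1, hn.2⟩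
          have hnT : (n : ℝ) ≤ 400 * y := by
            rw [Finset.mem_Ioc] at hn; exact_mod_cast hn.2
          exact mul_le_mul_of_nonneg_left (hcount n hn' _ hnT) (hd0 n hn')
  rw [← Finset.sum_Ioc_consecutive _ hym hmz]
  have e : (0.9009 / Real.log (20 * y) + 0.09244 / Real.log (400 * y)) / y =
      0.9009 / y / Real.log (20 * y) + 0.09244 / y / Real.log (400 * y) := by
    field_simp
  rw [e]
  exact add_le_add hpiece0 hpiece1

/-- R1 · `gain_caseA6W` re-read RH-free (gen 13; no `B`). Case A (`Q ≥ 6√P`) for `2·10¹⁹ ≤ P`: `G ≥ 2.9/(√P log P)`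
(`θ(Q) ≥ 0.99947·6√P`, `R ≤ 2.0004 P`, `log R ≤ 1.0157 log P`; `2.9·2.0004·1.0157 ≤ 5.99682`). -/
theorem gain_caseA6R (h18 : Buthe2018_thm2_theta) (h21 : BroadbentEtAl2021_theta_rel_1e19) {P Q : ℕ}
    (hP : (2 * 10 ^ 19 : ℝ) ≤ P) (hQP : Q ≤ P) (hQ : 6 * √(P : ℝ) ≤ Q) :
    2.9 / (√(P : ℝ) * Real.log P) ≤ θ Q / ((θ P + θ Q) * Real.log (θ P + θ Q)) := by
  have hP10 := P_ge_2e10_of19 hP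
  have hL := logP_ge19 hP
  have hsP := sqrtP_ge19 hP
  have hsq := sq_sqrtP hP10
  have hP0 := P_pos hP10
  obtain ⟨hθP1, hθP2⟩ := thetaP_boundsR h18 h21 hP10
  have hQ30 : (2 : ℝ) ^ 30 ≤ Q := by nlinarith
  have hθQ1 : 0.99947 * Q ≤ θ Q := theta_ge_99947R h18 h21 hQ30
  have hθQP : θ Q ≤ θ P := Chebyshev.theta_mono (by exact_mod_cast hQP)
  set R := θ P + θ Q with hR
  have hR1 : R ≤ 2.0004 * P := by linarith
  have hQnn : (0 : ℝ) ≤ Q := Nat.cast_nonneg Q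
  have hRpos : 1 < R := by nlinarith
  have hlogR0 : 0 < Real.log R := Real.log_pos hRpos
  have hlogR : Real.log R ≤ 1.0157 * Real.log P := by
    have h1 : Real.log R ≤ Real.log (2.0004 * P) := Real.log_le_log (by linarith) hR1
    rw [Real.log_mul (by norm_num) hP0.ne'] at h1
    have h2 : Real.log (2.0004 : ℝ) ≤ 0.6934 := by
      rw [show (2.0004 : ℝ) = 2 * 1.0002 by norm_num, Real.log_mul (by norm_num) (by norm_num)]
      have := Real.log_two_lt_d9
      have := Real.log_le_sub_one_of_pos (show (0 : ℝ) < 1.0002 by norm_num)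
      linarith
    linarith
  rw [div_le_div_iff₀ (by positivity) (by positivity)]
  have hRlogR : R * Real.log R ≤ (2.0004 * P) * (1.0157 * Real.log P) :=
    mul_le_mul hR1 hlogR hlogR0.le (by positivity)
  have hθQ : 5.99682 * √(P : ℝ) ≤ θ Q := by linarith
  calc 2.9 * ((θ P + θ Q) * Real.log (θ P + θ Q)) = 2.9 * (R * Real.log R) := by rw [hR]
    _ ≤ 2.9 * ((2.0004 * P) * (1.0157 * Real.log P)) := by gcongr
    _ = (2.9 * 2.0004 * 1.0157) * (√(P : ℝ) * √(P : ℝ)) * Real.log P := by rw [hsq]; ring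
    _ ≤ 5.99682 * (√(P : ℝ) * √(P : ℝ)) * Real.log P := by gcongr; norm_num
    _ = 5.99682 * √(P : ℝ) * (√(P : ℝ) * Real.log P) := by ring
    _ ≤ θ Q * (√(P : ℝ) * Real.log P) := by gcongr

/-- R1 · `gain_caseC6W` re-read RH-free (gen 13; no `B`). Case C (gain from `Q`, `√P/4 < Q < 6√P`) for `2·10¹⁹ ≤ P`: `G ≥ 0.99925·Q/(P log P)`
(`θ(Q) ≥ 0.99947 Q`, `θ(Q) ≤ 1.00053·6√P ≤ 1.4·10⁻⁹ P`, `R ≤ 1.00021 P`, `log R ≤ 1.0000048 log P`). -/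
theorem gain_caseC6R (h18 : Buthe2018_thm2_theta) (h21 : BroadbentEtAl2021_theta_rel_1e19) {P Q : ℕ}
    (hP : (2 * 10 ^ 19 : ℝ) ≤ P) (hQlo : √(P : ℝ) / 4 < Q) (hQhi : (Q : ℝ) < 6 * √(P : ℝ)) :
    0.99925 * Q / ((P : ℝ) * Real.log P) ≤ θ Q / ((θ P + θ Q) * Real.log (θ P + θ Q)) := by
  have hP10 := P_ge_2e10_of19 hP
  have hL := logP_ge19 hP
  have hsP := sqrtP_ge19 hP
  have hsq := sq_sqrtP hP10
  have hP0 := P_pos hP10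
  obtain ⟨hθP1, hθP2⟩ := thetaP_boundsR h18 h21 hP10
  have hQ30 : (2 : ℝ) ^ 30 ≤ Q := by nlinarith
  have hQ0 : (0 : ℝ) < Q := by linarith
  have hθQ1 : 0.99947 * Q ≤ θ Q := theta_ge_99947R h18 h21 hQ30
  have hθQ2 : θ Q ≤ 0.0000000014 * P := by
    have h1 : θ Q ≤ 1.00053 * Q := theta_le_100053R h18 h21 hQ30
    have h3 : √(P : ℝ) * 4472135954 ≤ P :=
      calc √(P : ℝ) * 4472135954 ≤ √(P : ℝ) * √(P : ℝ) :=
            mul_le_mul_of_nonneg_left hsP (Real.sqrt_nonneg _)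
        _ = P := hsq
    nlinarith
  set R := θ P + θ Q with hR
  have hR1 : R ≤ 1.00021 * P := by linarith
  have hRpos : 1 < R := by nlinarith
  have hlogR0 : 0 < Real.log R := Real.log_pos hRpos
  have hlogR : Real.log R ≤ 1.0000048 * Real.log P := by
    have h1 : Real.log R ≤ Real.log (1.00021 * P) := Real.log_le_log (by linarith) hR1
    rw [Real.log_mul (by norm_num) hP0.ne'] at h1
    have h2 := Real.log_le_sub_one_of_pos (show (0 : ℝ) < 1.00021 by norm_num)
    linarith
  rw [div_le_div_iff₀ (by positivity) (by positivity)]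
  have hRlogR : R * Real.log R ≤ (1.00021 * P) * (1.0000048 * Real.log P) :=
    mul_le_mul hR1 hlogR hlogR0.le (by positivity)
  calc 0.99925 * Q * ((θ P + θ Q) * Real.log (θ P + θ Q)) = 0.99925 * Q * (R * Real.log R) := by
        rw [hR]
    _ ≤ 0.99925 * Q * ((1.00021 * P) * (1.0000048 * Real.log P)) := by gcongr
    _ = (0.99925 * 1.00021 * 1.0000048) * Q * (P * Real.log P) := by ring
    _ ≤ 0.99947 * Q * (P * Real.log P) := by gcongr; norm_num
    _ ≤ θ Q * (P * Real.log P) := by gcongr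

/-- R1 · `window_caseC6W` re-read RH-free (gen 13; no `B`). Case C (two-piece window, `√P/4 < Q < 6√P`) for `2·10¹⁹ ≤ P`, with a lower enclosure
`L₁ ≤ log P`: `S ≥ s(L₁)/(Q log P)`, `s(L₁) = 1.8018 L₁/(L₁ + 9.6567) + 0.18488 L₁/(L₁ + 15.6481)`
(`window_bound2W` at `y = Q`; `log(20Q) ≤ 3 log 5 + log P/2`, `log(400Q) ≤ 4 log 5 + 2 log 2 + log P/2`). -/
theorem window_caseC6R (h18 : Buthe2018_thm2_theta) (h21 : BroadbentEtAl2021_theta_rel_1e19) {P Q : ℕ}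
    (hP : (2 * 10 ^ 19 : ℝ) ≤ P) (hQlo : √(P : ℝ) / 4 < Q) (hQhi : (Q : ℝ) < 6 * √(P : ℝ))
    {L₁ : ℝ} (hL₁ : L₁ ≤ Real.log P) (hL₁0 : 0 < L₁) :
    (1.8018 * L₁ / (L₁ + 9.6567) + 0.18488 * L₁ / (L₁ + 15.6481)) / ((Q : ℝ) * Real.log P) ≤
      ∑ p ∈ (Nat.primesLE P).filter (fun p => Q < p), ((p : ℝ) ^ 2)⁻¹ := by
  have hP10 := P_ge_2e10_of19 hP
  have hL := logP_ge19 hP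
  have hsP := sqrtP_ge19 hP
  have hsq := sq_sqrtP hP10
  have hP0 := P_pos hP10
  have hQ30 : (2 : ℝ) ^ 30 ≤ Q := by nlinarith
  have hQ0 : (0 : ℝ) < Q := by linarith
  have hQP : 400 * Q ≤ P := by
    have : (400 * Q : ℝ) ≤ P := by nlinarith
    exact_mod_cast this
  have hw := window_bound2R h18 h21 hQ30 hQP le_rfl
  refine le_trans ?_ hw
  obtain ⟨h5l, h5u⟩ := log_five_bounds
  have h2u := Real.log_two_lt_d9
  have hlog20Q : Real.log (20 * Q) ≤ 4.82832 + Real.log P / 2 := by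
    have h1 : Real.log (20 * Q) ≤ Real.log (125 * √(P : ℝ)) :=
      Real.log_le_log (by positivity) (by linarith)
    have h5 : Real.log (125 * √(P : ℝ)) = Real.log 125 + Real.log P / 2 := by
      rw [Real.log_mul (by norm_num) (ne_of_gt (by positivity)), log_sqrtP hP10]
    have h125 : Real.log (125 : ℝ) = 3 * Real.log 5 := by
      rw [show (125 : ℝ) = 5 ^ 3 by norm_num, Real.log_pow]; push_cast; ring
    linarith
  have hlog400Q : Real.log (400 * Q) ≤ 7.824047 + Real.log P / 2 := by
    have h1 : Real.log (400 * Q) ≤ Real.log (2500 * √(P : ℝ)) :=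
      Real.log_le_log (by positivity) (by linarith)
    have h5 : Real.log (2500 * √(P : ℝ)) = Real.log 2500 + Real.log P / 2 := by
      rw [Real.log_mul (by norm_num) (ne_of_gt (by positivity)), log_sqrtP hP10]
    have h2500 : Real.log (2500 : ℝ) = 4 * Real.log 5 + 2 * Real.log 2 := by
      rw [show (2500 : ℝ) = 5 ^ 4 * 2 ^ 2 by norm_num, Real.log_mul (by norm_num) (by norm_num),
        Real.log_pow, Real.log_pow]
      push_cast; ring
    linarith
  have hlog20Q0 : 0 < Real.log (20 * Q) := Real.log_pos (by linarith)
  have hlog400Q0 : 0 < Real.log (400 * Q) := Real.log_pos (by linarith)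
  have hLP : 0 < Real.log P := by linarith
  -- one piece: `a L₁/(L₁ + k) ≤ (a/2) log P / lT` when `lT ≤ k/2 + log P/2` (`L/(L + k)` increasing in `L`)
  have piece : ∀ {a k lT : ℝ}, 0 < a → 0 < k → 0 < lT → lT ≤ k / 2 + Real.log P / 2 →
      a * L₁ / (L₁ + k) ≤ (a / 2) * Real.log P / lT := by
    intro a k lT ha hk hlT0 hlT
    rw [div_le_div_iff₀ (by linarith) hlT0]
    have h1 : L₁ * lT ≤ (L₁ + k) * Real.log P / 2 := by
      nlinarith [mul_le_mul_of_nonneg_left hlT hL₁0.le, mul_le_mul_of_nonneg_left hL₁ hk.le]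
    nlinarith [mul_le_mul_of_nonneg_left h1 ha.le]
  have hp0 := piece (a := 1.8018) (k := 9.6567) (lT := Real.log (20 * Q)) (by norm_num) (by norm_num)
    hlog20Q0 (by linarith)
  have hp1 := piece (a := 0.18488) (k := 15.6481) (lT := Real.log (400 * Q)) (by norm_num) (by norm_num)
    hlog400Q0 (by linarith)
  have e : (0.9009 / Real.log (20 * Q) + 0.09244 / Real.log (400 * Q)) / (Q : ℝ) =
      ((1.8018 / 2) * Real.log P / Real.log (20 * Q) + (0.18488 / 2) * Real.log P / Real.log (400 * Q)) /
        ((Q : ℝ) * Real.log P) := by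
    have hQne : (Q : ℝ) ≠ 0 := hQ0.ne'
    have hLne : Real.log P ≠ 0 := hLP.ne'
    have h20ne : Real.log (20 * Q) ≠ 0 := hlog20Q0.ne'
    have h400ne : Real.log (400 * Q) ≠ 0 := hlog400Q0.ne'
    field_simp
    ring
  rw [e]
  exact div_le_div_of_nonneg_right (add_le_add hp0 hp1) (by positivity)

end LargePRel

end Summit.RiemannHypothesis.RiemannHypothesis.Theorems.Splittings.RobinFiniteE3

end
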